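import Mathlib
import Literature.AlgebraicGeometry.Resolution.CobordantGame
import Literature.AlgebraicGeometry.Resolution.CobordantChartCoefficients
import Literature.AlgebraicGeometry.Resolution.CobordantChartPlaneSlice
import Literature.AlgebraicGeometry.Resolution.CobordantTupleGame
import Summits.ResolutionOfSingularities.ResolutionOfSingularities.Theorems.WeightedInvariantLocalWeightedDropWildTerminalApex

/-!
# `WeightedInvariant.LocalWeightedDrop`, line `hasse-ridge-face-selection`: CLEANNESS IS PRESERVED by the monomial steps of the
# purely inseparable sub-game (point blow-up at an exceptional point on a coordinate axis; curve blow-up)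

Crux item stmt-ResolutionOfSingularities-8899 `LocalWeightedDrop` (route `ResolutionOfSingularities/WeightedInvariant`),
serving the door `WeightedConstruction` stmt-ResolutionOfSingularities-0571.  [OURS · L1 W4.3, chain w43, stub worker 1
(gen 2): infrastructure (N1) of the S3πM design note for the piece `stub_wildPurelyInseparableReductionWon`; the printed remark
is Hauser–Perlega, PRIMS 60 (2024) §2 p. 774: «the expansion of `F′` is again clean if either `Z = V(x,z)` or `Z = {a}` and
`t = 0` … we say in this case that the localized blowup is monomial».  Not a statement of any manuscript; elementary.]

`A ∈ k[[x₁,x₂]]` is CLEAN for `q` when it has no monomial `x₁^{qα₁} x₂^{qα₂}` (spelled out as a hypothesis, no definition).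
* `coeff_slice_subst_pointChart_axis₀` / `₁`: the point chart at an exceptional point ON AN AXIS (`c = (c₁, 0)`, slot `0`;
  resp. `c = (0, c₂)`, slot `1`) followed by the slice, coefficient by coefficient — the monomial `x₁^a x₂^b` goes to
  `c₁^a · s^{a+b} x₂'^b` (resp. `c₂^b · s^{a+b} x₂'^{a}`), so the coefficient of `s^r x₂'^j` is `c₁^{r-j} [x₁^{r-j} x₂^j] A`;
* `clean_slice_subst_pointChart_axis₀` / `₁`, `clean_of_X_pow_mul_clean`, `clean_slice_subst_axisChart`,
  `clean_C_mul`: cleanness passes to the successor coefficients of `WildPurePower.won_purePower_of_pointStep` at axis points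
  and of `won_purePower_of_curveStep` (the exponent maps `(a,b) ↦ (a+b,b)`, shifts by `q·e₁`, and coordinate permutations
  preserve the lattice `q·ℕ²`).  At exceptional points OFF the axes (`t ≠ 0`) cleanness is NOT preserved (new `p^e`-th powers:
  the kangaroo phenomenon) — nothing is claimed there.
-/

set_option linter.dupNamespace false -- mandated namespace of this single-conjunct summit

namespace Summit.ResolutionOfSingularities.ResolutionOfSingularities.Theorems

open Literature.AlgebraicGeometry.Resolution

namespace WildPurePower

open MvPowerSeries WildTerminal Literature.AlgebraicGeometry.Resolution.CobordantGame

variable {k : Type} [Field k]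

/-! ### The point chart at an axis point, in coefficients -/

/-- The generic term of the point-chart sum at the axis point `c = (c₁, 0)` read through the slice `y₁ = 0`. -/
theorem finsum_pointChart_axis_eq (c₀ : k) (A : MvPowerSeries (Fin 2) k) (r j : ℕ) :
    (∑ᶠ d : Fin 2 →₀ ℕ, if Finsupp.weight (fun _ : Fin 2 => 1) d = r then
        coeff d A * ∏ l, (((d l).choose ((Finsupp.single (1 : Fin 2) j : Fin 2 →₀ ℕ) l) : k) *
          (fun l : Fin 2 => if l = 0 then c₀ else 0) l ^ (d l - (Finsupp.single (1 : Fin 2) j : Fin 2 →₀ ℕ) l))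
      else 0) =
      if j ≤ r then c₀ ^ (r - j) * coeff (Finsupp.single 0 (r - j) + Finsupp.single 1 j) A else 0 := by
  classical
  by_cases hjr : j ≤ r
  · rw [if_pos hjr, finsum_eq_single _ (Finsupp.single 0 (r - j) + Finsupp.single 1 j)]
    · rw [ApexFreeOrderDrop.weight_one_eq_degree, if_pos (by
        rw [map_add, Finsupp.degree_single, Finsupp.degree_single]; omega), Fin.prod_univ_two]
      simp [mul_comm]
    · intro d hd
      by_cases hw : Finsupp.weight (fun _ : Fin 2 => 1) d = r
      · rw [if_pos hw]
        rw [ApexFreeOrderDrop.weight_one_eq_degree] at hw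
        have hdeg : d.degree = d 0 + d 1 := by simp [Finsupp.degree_eq_sum, Fin.sum_univ_two]
        have hd1 : d 1 ≠ j := by
          intro h
          apply hd
          ext l
          fin_cases l
          · simp; omega
          · simp [h]
        have hzero : (((d 1).choose ((Finsupp.single (1 : Fin 2) j : Fin 2 →₀ ℕ) 1) : k) *
            (fun l : Fin 2 => if l = 0 then c₀ else 0) 1 ^ (d 1 - (Finsupp.single (1 : Fin 2) j : Fin 2 →₀ ℕ) 1)) = 0 := by
          simp only [Finsupp.single_eq_same, one_ne_zero, if_false]
          rcases lt_or_gt_of_ne hd1 with hlt | hgt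
          · rw [Nat.choose_eq_zero_of_lt hlt, Nat.cast_zero, zero_mul]
          · rw [zero_pow (Nat.sub_ne_zero_of_lt hgt), mul_zero]
        rw [Finset.prod_eq_zero (Finset.mem_univ (1 : Fin 2)) hzero, mul_zero]
      · rw [if_neg hw]
  · rw [if_neg hjr]
    refine finsum_eq_zero_of_forall_eq_zero fun d => ?_
    by_cases hw : Finsupp.weight (fun _ : Fin 2 => 1) d = r
    · rw [if_pos hw]
      rw [ApexFreeOrderDrop.weight_one_eq_degree] at hw
      have hdeg : d.degree = d 0 + d 1 := by simp [Finsupp.degree_eq_sum, Fin.sum_univ_two]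
      have hlt : d 1 < j := by omega
      have hzero : (((d 1).choose ((Finsupp.single (1 : Fin 2) j : Fin 2 →₀ ℕ) 1) : k) *
          (fun l : Fin 2 => if l = 0 then c₀ else 0) 1 ^ (d 1 - (Finsupp.single (1 : Fin 2) j : Fin 2 →₀ ℕ) 1)) = 0 := by
        simp only [Finsupp.single_eq_same]
        rw [Nat.choose_eq_zero_of_lt hlt, Nat.cast_zero, zero_mul]
      rw [Finset.prod_eq_zero (Finset.mem_univ (1 : Fin 2)) hzero, mul_zero]
    · rw [if_neg hw]

/-- THE POINT CHART AT THE AXIS POINT `c = (c₁, 0)` FOLLOWED BY THE SLICE `y₁ = 0`, IN COEFFICIENTS: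
`[s^r x₂'^j] (A ∘ chart(c))| = c₁^{r-j} · [x₁^{r-j} x₂^j] A` (and `0` if `j > r`). -/
theorem coeff_slice_subst_pointChart_axis₀ (c : Fin 2 → k) (hc : c 1 = 0) (A : MvPowerSeries (Fin 2) k) (β : Fin 2 →₀ ℕ) :
    coeff β (TupleGame.slice (0 : Fin 2) (subst (CobordantChart.chart (fun _ : Fin 2 => 1) c) A)) =
      if β 1 ≤ β 0 then c 0 ^ (β 0 - β 1) * coeff (Finsupp.single 0 (β 0 - β 1) + Finsupp.single 1 (β 1)) A else 0 := by
  have hcfun : c = fun l : Fin 2 => if l = 0 then c 0 else 0 := by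
    funext l
    fin_cases l
    · simp
    · simpa using hc
  unfold TupleGame.slice
  rw [CobordantChartPlaneSlice.coeff_subst_slice, show Fin.succ (0 : Fin 2) = Fin.succ (0 : Fin 2) from rfl,
    CobordantChartPlaneSlice.mapDomain_succAbove_one,
    CobordantChart.coeff_subst_chart _ _ (fun l hl => absurd hl one_ne_zero)]
  conv_lhs => rw [hcfun]
  exact finsum_pointChart_axis_eq (c 0) A (β 0) (β 1)

/-! ### Cleanness and its transport -/

/-- A shift by `q · e₁` preserves cleanness (reading `x₁^q · T` instead of `T`). -/
theorem clean_of_X_pow_mul_clean (q : ℕ) (T : MvPowerSeries (Fin 2) k)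
    (h : ∀ β : Fin 2 →₀ ℕ, (∀ i, q ∣ β i) → coeff β ((X 0 : MvPowerSeries (Fin 2) k) ^ q * T) = 0) :
    ∀ β : Fin 2 →₀ ℕ, (∀ i, q ∣ β i) → coeff β T = 0 := by
  classical
  intro β hβ
  have h' := h (β + Finsupp.single 0 q) (fun i => by
    rw [Finsupp.add_apply, Finsupp.single_apply]
    split_ifs
    · exact dvd_add (hβ i) dvd_rfl
    · rw [add_zero]; exact hβ i)
  rwa [X_pow_eq, coeff_monomial_mul, if_pos (by
    intro i; rw [Finsupp.add_apply]; exact le_add_self), one_mul, add_tsub_cancel_right] at h'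

/-- Conversely `x_i^q · A` is clean when `A` is. -/
theorem clean_X_pow_mul (q : ℕ) (i : Fin 2) (A : MvPowerSeries (Fin 2) k)
    (h : ∀ β : Fin 2 →₀ ℕ, (∀ l, q ∣ β l) → coeff β A = 0) :
    ∀ β : Fin 2 →₀ ℕ, (∀ l, q ∣ β l) → coeff β ((X i : MvPowerSeries (Fin 2) k) ^ q * A) = 0 := by
  classical
  intro β hβ
  rw [X_pow_eq, coeff_monomial_mul]
  split_ifs with hle
  · rw [one_mul, h]
    intro l
    rw [Finsupp.tsub_apply, Finsupp.single_apply]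
    split_ifs
    · exact Nat.dvd_sub (hβ l) dvd_rfl
    · rw [Nat.sub_zero]; exact hβ l
  · rfl

/-- A constant multiple of a clean series is clean. -/
theorem clean_C_mul (q : ℕ) (a : k) (A : MvPowerSeries (Fin 2) k)
    (h : ∀ β : Fin 2 →₀ ℕ, (∀ l, q ∣ β l) → coeff β A = 0) :
    ∀ β : Fin 2 →₀ ℕ, (∀ l, q ∣ β l) → coeff β (C a * A) = 0 := by
  intro β hβ
  rw [coeff_C_mul, h β hβ, mul_zero]

/-- THE MONOMIAL POINT STEP KEEPS CLEANNESS: at the axis point `c = (c₁, 0)` (slot `0`) the sliced transform of a clean `A`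
is clean. -/
theorem clean_slice_subst_pointChart_axis₀ (q : ℕ) (c : Fin 2 → k) (hc : c 1 = 0) (A : MvPowerSeries (Fin 2) k)
    (h : ∀ β : Fin 2 →₀ ℕ, (∀ l, q ∣ β l) → coeff β A = 0) :
    ∀ β : Fin 2 →₀ ℕ, (∀ l, q ∣ β l) →
      coeff β (TupleGame.slice (0 : Fin 2) (subst (CobordantChart.chart (fun _ : Fin 2 => 1) c) A)) = 0 := by
  classical
  intro β hβ
  rw [coeff_slice_subst_pointChart_axis₀ c hc A β]
  split_ifs with hle
  · rw [h, mul_zero]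
    intro l
    rw [Finsupp.add_apply, Finsupp.single_apply, Finsupp.single_apply]
    fin_cases l
    · simpa using Nat.dvd_sub (hβ 0) (hβ 1)
    · simpa using hβ 1
  · rfl

/-- THE SUCCESSOR COEFFICIENT OF THE POINT STEP AT AN AXIS POINT IS CLEAN: with `A ∘ chart(c) = s^{q+1} B₀`, `c = (c₁, 0)`,
the coefficient `(s · B₀)|_{y₁ = 0}` of `WildPurePower.won_purePower_of_pointStep` is clean when `A` is. -/
theorem clean_pointStep_axis₀ (q : ℕ) (c : Fin 2 → k) (hc : c 1 = 0) (A : MvPowerSeries (Fin 2) k)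
    (h : ∀ β : Fin 2 →₀ ℕ, (∀ l, q ∣ β l) → coeff β A = 0) (B₀ : MvPowerSeries (Fin (2 + 1)) k)
    (hB : subst (CobordantChart.chart (fun _ : Fin 2 => 1) c) A = X 0 ^ (q + 1) * B₀) :
    ∀ β : Fin 2 →₀ ℕ, (∀ l, q ∣ β l) → coeff β (TupleGame.slice (0 : Fin 2) (X 0 * B₀)) = 0 := by
  refine clean_of_X_pow_mul_clean q _ fun β hβ => ?_
  rw [← slice_X_zero (0 : Fin 2), ← slice_pow, ← slice_mul, ← mul_assoc, ← pow_succ, ← hB]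
  exact clean_slice_subst_pointChart_axis₀ q c hc A h β hβ

/-- THE CURVE STEP KEEPS CLEANNESS: the sliced axis-chart transform `(A ∘ chart_i(c))|` of a clean `A` is clean (the exponent
map is a coordinate permutation weighted by powers of `c`). -/
theorem clean_slice_subst_axisChart (q : ℕ) (i : Fin 2) (ci : k) (A : MvPowerSeries (Fin 2) k)
    (h : ∀ β : Fin 2 →₀ ℕ, (∀ l, q ∣ β l) → coeff β A = 0) :
    ∀ β : Fin 2 →₀ ℕ, (∀ l, q ∣ β l) →
      coeff β (TupleGame.slice i (subst (CobordantChart.chart (fun l : Fin 2 => if l = i then 1 else 0)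
        (fun l : Fin 2 => if l = i then ci else 0)) A)) = 0 := by
  classical
  intro β hβ
  have hi : i = 0 ∨ i = 1 := by fin_cases i <;> simp
  rcases hi with rfl | rfl
  · rw [coeff_slice_subst_axisChart_zero, h, mul_zero]
    intro l
    rw [Finsupp.add_apply, Finsupp.single_apply, Finsupp.single_apply]
    fin_cases l
    · simpa using hβ 0
    · simpa using hβ 1
  · rw [coeff_slice_subst_axisChart_one, h, mul_zero]
    intro l
    rw [Finsupp.add_apply, Finsupp.single_apply, Finsupp.single_apply]
    fin_cases l
    · simpa using hβ 1
    · simpa using hβ 0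

/-- THE SUCCESSOR COEFFICIENT OF THE CURVE STEP IS CLEAN: `c^q · (A'' ∘ chart_i(c))|` of
`WildPurePower.won_purePower_of_curveStep` is clean when `A''` is. -/
theorem clean_curveStep (q : ℕ) (i : Fin 2) (ci : k) (A'' : MvPowerSeries (Fin 2) k)
    (h : ∀ β : Fin 2 →₀ ℕ, (∀ l, q ∣ β l) → coeff β A'' = 0) :
    ∀ β : Fin 2 →₀ ℕ, (∀ l, q ∣ β l) →
      coeff β (C (ci ^ q) * TupleGame.slice i (subst (CobordantChart.chart (fun l : Fin 2 => if l = i then 1 else 0)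
        (fun l : Fin 2 => if l = i then ci else 0)) A'')) = 0 :=
  clean_C_mul q _ _ (clean_slice_subst_axisChart q i ci A'' h)

end WildPurePower

end Summit.ResolutionOfSingularities.ResolutionOfSingularities.Theorems
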